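import Literature.Computability.AlgebraicComplexity.LaserMethodTypeCount
import Literature.Computability.AlgebraicComplexity.LaserMethodBigCW
import HarnessLib

/-!
# A large free diagonal of the far-rectangular joint type of `CW_q` (stub `stub_cwRectDiagonalRaw`)

Route `MatrixMultiplication/ShapeSubmodularity` (crux shared verbatim with route `EPRFaces`), crux
`stmt-MatrixMultiplication-10893` (`PerfectAmortisation`, `E : ∀ ε > 0, ∃ k ≥ 1,
R(⟨n, n, n^k⟩) = O(n^{k+1+ε})`), line `registered` (skeleton `Lines/birth.lean`); support lemma
(stub B1, the COMBINATORIAL layer of the first-power laser method on the Coppersmith–Winograd tensor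
`CW_q` with the far-rectangular joint type).

Let `k, m ≥ 1`, `N = (k+2) m`, and let `Q` be the count vector on `{0,1,2}³` with `Q(1,1,0) = m`,
`Q(0,1,1) = m`, `Q(1,0,1) = k m` and `0` elsewhere (so `Q` is supported in the tight set
`S = {i+j+l = 2} = cwSupport₃` and `∑ Q = N`), `P = Q / N`.  Then inside the set `Φ_Q` of triples of
label words `(x, y, z) ∈ ({0,1,2}^N)³` of joint type `Q` there is a FREE diagonal `Δ` (free with
respect to the coordinatewise support `S^N`) with

  `2^{N (min_m H(P_m) − Γ_S(P))} ≤ |Δ| · (N+1)^63 · 192 · exp(4 √(log 6 + N log 27))`.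

This is exactly the tree theorem
`Literature.Computability.AlgebraicComplexity.exists_free_diagonal_jointType_card`
(`LaserMethodTypeCount.lean`; Le Gall 2014, Appendix A.3, Eq. (7) and p. 24, with Behrend's bound for
the Salem–Spencer loss) instantiated at `S = cwSupport₃`, `r = 1`, `b = 2`, the tightness maps
`α = β = (i ↦ i)`, `γ = (l ↦ l − 2)` of `bigCw_laser_inequality` (`LaserMethodBigCW.lean`), and the
numerical constants of `Fin 3 × Fin 3 × Fin 3` evaluated (`G = 27`, `A = 3+3+3`, `max b 1 = 2`, so the
exponent is `2·27 + 9 = 63`, `96 · 2 = 192`, `3 · 2 = 6`).  The membership `Δ ⊆ Φ_Q` is unfolded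
into the three letter counts and the coordinatewise support condition (a letter outside `S` would
have count `Q = 0`, contradicting `letterCount_pos_of_apply`).

No new definitions, no named facts; everything used is proved in the tree.
-/

-- single-conjunct summit: the mandated namespace repeats `MatrixMultiplication`.
set_option linter.dupNamespace false

noncomputable section

open Finset
open scoped BigOperators

namespace Summit.MatrixMultiplication.MatrixMultiplication.Theorems.PerfectAmortisation

open Literature.Computability.AlgebraicComplexity

/-- **Stub B1 (combinatorial layer: a large free diagonal of the far-rectangular joint type).**
For `k, m ≥ 1`, `N = (k+2) m` and `P = Q/N` with `Q(1,1,0) = Q(0,1,1) = m`, `Q(1,0,1) = k m`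
(`0` elsewhere), there is a family `Δ` of triples of level words `(x, y, z) ∈ ({0,1,2}^N)³`,
coordinatewise in `cwSupport₃ = {i+j+l = 2}`, each with exactly `m`, `m`, `k m` positions of pattern
`(1,1,0)`, `(0,1,1)`, `(1,0,1)`, forming a free diagonal, with
`2^{N (min_m H(P_m) − Γ_S(P))} ≤ |Δ| · (N+1)^63 · 192 · exp(4 √(log 6 + N log 27))`
(`exists_free_diagonal_jointType_card` for `S = cwSupport₃`, `b = 2`, `G = 27`, `A = 9`).
[cite: LeGall2014, Appendix A.3, Eq. (7) and p. 24] -/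
theorem stub_cwRectDiagonalRaw :
    ∀ m k : ℕ, 1 ≤ m → 1 ≤ k → ∀ P : Fin 3 × Fin 3 × Fin 3 → ℝ,
      (∀ s, P s = ((if s = (1, 1, 0) then m else if s = (0, 1, 1) then m
          else if s = (1, 0, 1) then k * m else 0 : ℕ) : ℝ) / (((k + 2) * m : ℕ) : ℝ)) →
      ∃ Δ : Finset ((Fin ((k + 2) * m) → Fin 3) × (Fin ((k + 2) * m) → Fin 3) ×
          (Fin ((k + 2) * m) → Fin 3)),
        (∀ δ ∈ Δ, ∀ ρ, labelSeq δ ρ ∈ cwSupport₃) ∧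
        (∀ δ ∈ Δ, letterCount (labelSeq δ) (1, 1, 0) = m ∧ letterCount (labelSeq δ) (0, 1, 1) = m ∧
          letterCount (labelSeq δ) (1, 0, 1) = k * m) ∧
        (∀ δ ∈ Δ, ∀ δ' ∈ Δ, ∀ δ'' ∈ Δ, (∀ ρ, (δ.1 ρ, δ'.2.1 ρ, δ''.2.2 ρ) ∈ cwSupport₃) →
          δ = δ' ∧ δ' = δ'') ∧
        (2 : ℝ) ^ ((((k + 2) * m : ℕ) : ℝ) *
            (min (shannonEntropy (marginalDist₁ P))
              (min (shannonEntropy (marginalDist₂ P)) (shannonEntropy (marginalDist₃ P))) -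
              maxEntropyPenalty cwSupport₃ P)) ≤
          (Δ.card : ℝ) * ((((k + 2) * m : ℕ) : ℝ) + 1) ^ 63 * 192 *
            Real.exp (4 * Real.sqrt (Real.log 6 + (((k + 2) * m : ℕ) : ℝ) * Real.log 27)) := by
  intro m k hm hk P hP
  classical
  -- tightness data of `cwSupport₃` (as in `bigCw_laser_inequality`)
  have hinj : Function.Injective fun (i : Fin 3) (_ : Fin 1) => (i : ℤ) := by
    intro i i' h
    have h0 := congrFun h 0
    simp only [Nat.cast_inj] at h0
    exact Fin.ext h0
  have hinjγ : Function.Injective fun (l : Fin 3) (_ : Fin 1) => (l : ℤ) - 2 := by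
    intro l l' h
    have h0 := congrFun h 0
    simp only [sub_left_inj, Nat.cast_inj] at h0
    exact Fin.ext h0
  have hbd : ∀ (i : Fin 3) (ρ : Fin 1), |((fun (i : Fin 3) (_ : Fin 1) => (i : ℤ)) i ρ)| ≤ (2 : ℕ) := by
    intro i ρ
    have := i.isLt
    simp only [Nat.cast_ofNat, Nat.abs_cast]
    omega
  have htight : ∀ s ∈ cwSupport₃, ∀ ρ : Fin 1,
      (fun (i : Fin 3) (_ : Fin 1) => (i : ℤ)) s.1 ρ + (fun (j : Fin 3) (_ : Fin 1) => (j : ℤ)) s.2.1 ρ +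
        (fun (l : Fin 3) (_ : Fin 1) => (l : ℤ) - 2) s.2.2 ρ = 0 := by
    intro s hs ρ
    rw [mem_cwSupport₃] at hs
    simp only
    omega
  -- the joint type `Q` and `N = (k+2) m`
  obtain ⟨Q, hQdef⟩ : ∃ Q : Fin 3 × Fin 3 × Fin 3 → ℕ, Q = fun s =>
      if s = (1, 1, 0) then m else if s = (0, 1, 1) then m else if s = (1, 0, 1) then k * m else 0 :=
    ⟨_, rfl⟩
  have hN : 0 < (k + 2) * m := Nat.mul_pos (by omega) (by omega)
  have hQS : ∀ s, s ∉ cwSupport₃ → Q s = 0 := by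
    intro s hs
    rw [mem_cwSupport₃_iff] at hs
    push Not at hs
    obtain ⟨h1, h2, h3, -, -, -⟩ := hs
    simp [hQdef, h1, h2, h3]
  have hQ : ∑ s, Q s = (k + 2) * m := by
    rw [sum_triple_eq, hQdef]
    simp [Fin.sum_univ_three]
    ring
  have hP' : ∀ s, P s = (Q s : ℝ) / (((k + 2) * m : ℕ) : ℝ) := by
    intro s
    rw [hQdef]
    exact hP s
  -- the tree theorem
  obtain ⟨Δ, hΔQ, hfree, hsize⟩ := exists_free_diagonal_jointType_card cwSupport₃ (r := 1) (b := 2)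
    (fun (i : Fin 3) (_ : Fin 1) => (i : ℤ)) (fun (j : Fin 3) (_ : Fin 1) => (j : ℤ))
    (fun (l : Fin 3) (_ : Fin 1) => (l : ℤ) - 2) hinj hinj hinjγ hbd hbd htight hN Q hQS hQ P hP'
  have hQδ : ∀ δ ∈ Δ, letterCount (labelSeq δ) = Q := fun δ hδ => (Finset.mem_filter.1 (hΔQ hδ)).2
  refine ⟨Δ, ?_, ?_, hfree, ?_⟩
  · -- coordinatewise support
    intro δ hδ ρ
    by_contra hρ
    have h0 := hQS _ hρ
    rw [← hQδ δ hδ] at h0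
    exact (letterCount_pos_of_apply (labelSeq δ) ρ).ne' h0
  · -- the three letter counts
    intro δ hδ
    rw [hQδ δ hδ, hQdef]
    simp
  · -- the size bound, constants evaluated
    refine hsize.trans_eq ?_
    have hmax : (max 2 1 : ℕ) = 2 := by decide
    generalize (((k + 2) * m : ℕ) : ℝ) = Nr
    simp only [Fintype.card_prod, Fintype.card_fin, hmax]
    norm_num
    simp only [mul_assoc]

end Summit.MatrixMultiplication.MatrixMultiplication.Theorems.PerfectAmortisation
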